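import Literature.NumberTheory.ModularForms.InterpolationKernelTheorem
import Literature.NumberTheory.ModularForms.Lemma49Tools24
import Literature.NumberTheory.ModularForms.InterpolationKernelsClassP
import HarnessLib

/-!
# Joint continuity of the interpolation kernels in `(τ,z)` off the singular set

Cohn–Kumar–Miller–Radchenko–Viazovska, arXiv:1902.05438, Theorem 4.1: the kernels `𝒦±^{(d)}(τ,z)`
are meromorphic in both variables with poles only where `j(τ) = j(z)`. Since each kernel is an explicit
finite sum of products `f(τ)g(z)` of continuous functions divided by `Δ(z)(j(τ) − j(z))`, it is
JOINTLY continuous at every `(τ,z)` with `j(τ) ≠ j(z)` (needed for the locally uniform bounds in the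
holomorphy-in-`τ` argument of §5.1). PROVED here: `continuousAt_kernels_joint`.

## References

* H. Cohn, A. Kumar, S. D. Miller, D. Radchenko, M. Viazovska, Ann. of Math. 196 (2022),
  arXiv:1902.05438, Theorem 4.1, §5.1. [CohnEtAl2019]
-/

noncomputable section

open Complex hiding I
open Filter Topology ModularForm EisensteinSeries UpperHalfPlane
open Complex (I)
open scoped Real MatrixGroups ModularForm Manifold

namespace Literature.NumberTheory.ModularForms

open Literature.NumberTheory.EllipticCurves.ModularForms (kleinJ continuous_kleinJ)

attribute [fun_prop] continuous_phiNeg2 continuous_phi0 continuous_phi2 continuous_psi2 continuous_psi4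

/-- `continuous_phiTildeNeg2` (auxiliary). [cite: CohnEtAl2019, §4.2] -/
@[fun_prop] theorem continuous_phiTildeNeg2 : Continuous phiTildeNeg2 := isClassP_phiTildeNeg2.1.continuous
/-- `continuous_phiTilde0` (auxiliary). [cite: CohnEtAl2019, §4.2] -/
@[fun_prop] theorem continuous_phiTilde0 : Continuous phiTilde0 := isClassP_phiTilde0.1.continuous
/-- `continuous_phiTilde2` (auxiliary). [cite: CohnEtAl2019, §4.2] -/
@[fun_prop] theorem continuous_phiTilde2 : Continuous phiTilde2 := isClassP_phiTilde2.1.continuous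
/-- `continuous_psiTilde0` (auxiliary). [cite: CohnEtAl2019, §4.3] -/
@[fun_prop] theorem continuous_psiTilde0 : Continuous psiTilde0 := isClassP_psiTilde.1.1.continuous
/-- `continuous_psiTilde2` (auxiliary). [cite: CohnEtAl2019, §4.3] -/
@[fun_prop] theorem continuous_psiTilde2 : Continuous psiTilde2 := isClassP_psiTilde.2.1.1.continuous
/-- `continuous_psiTilde4` (auxiliary). [cite: CohnEtAl2019, §4.3] -/
@[fun_prop] theorem continuous_psiTilde4 : Continuous psiTilde4 := isClassP_psiTilde.2.2.1.continuous

/-- **Joint continuity off the singular set.** At every `(τ,z)` with `j(τ) ≠ j(z)` the four kernels and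
the full kernels `𝒦^{(8)}, 𝒦^{(24)}` are jointly continuous in `(τ,z)`. [cite: CohnEtAl2019, Theorem 4.1 (1)] -/
theorem continuousAt_kernels_joint {τ z : ℍ} (h : kleinJ τ ≠ kleinJ z) :
    ContinuousAt (fun p : ℍ × ℍ => kernelPlus8 p.1 p.2) (τ, z) ∧
    ContinuousAt (fun p : ℍ × ℍ => kernelMinus8 p.1 p.2) (τ, z) ∧
    ContinuousAt (fun p : ℍ × ℍ => kernelPlus24 p.1 p.2) (τ, z) ∧
    ContinuousAt (fun p : ℍ × ℍ => kernelMinus24 p.1 p.2) (τ, z) ∧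
    ContinuousAt (fun p : ℍ × ℍ => kernel8 p.1 p.2) (τ, z) ∧
    ContinuousAt (fun p : ℍ × ℍ => kernel24 p.1 p.2) (τ, z) := by
  have hD : ContinuousAt (fun p : ℍ × ℍ => ModularForm.discriminant p.2 * (kleinJ p.1 - kleinJ p.2)) (τ, z) := by
    fun_prop
  have hD0 : ModularForm.discriminant z * (kleinJ τ - kleinJ z) ≠ 0 :=
    mul_ne_zero (ModularForm.discriminant_ne_zero z) (sub_ne_zero.2 h)
  have c8p : ContinuousAt (fun p : ℍ × ℍ => kernelPlus8 p.1 p.2) (τ, z) := by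
    unfold kernelPlus8
    exact ((continuousAt_const.div hD hD0).mul (by fun_prop))
  have c8m : ContinuousAt (fun p : ℍ × ℍ => kernelMinus8 p.1 p.2) (τ, z) := by
    unfold kernelMinus8
    exact ((continuousAt_const.div hD hD0).mul (by fun_prop))
  have c24p : ContinuousAt (fun p : ℍ × ℍ => kernelPlus24 p.1 p.2) (τ, z) := by
    unfold kernelPlus24
    exact ((continuousAt_const.div hD hD0).mul (by fun_prop))
  have c24m : ContinuousAt (fun p : ℍ × ℍ => kernelMinus24 p.1 p.2) (τ, z) := by
    unfold kernelMinus24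
    exact ((continuousAt_const.div hD hD0).mul (by fun_prop))
  refine ⟨c8p, c8m, c24p, c24m, ?_, ?_⟩
  · show ContinuousAt (fun p : ℍ × ℍ => (kernelPlus8 p.1 p.2 + kernelMinus8 p.1 p.2) / 2) (τ, z)
    exact (c8p.add c8m).div_const 2
  · show ContinuousAt (fun p : ℍ × ℍ => (kernelPlus24 p.1 p.2 + kernelMinus24 p.1 p.2) / 2) (τ, z)
    exact (c24p.add c24m).div_const 2

/-- **Uniform bounds near a regular pair.** If `j(τ₀) ≠ j(z₀)` then the kernels are bounded on a
neighbourhood of `(τ₀,z₀)`. [cite: CohnEtAl2019, §5.1] -/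
theorem exists_bound_kernels_nhds {τ₀ z₀ : ℍ} (h : kleinJ τ₀ ≠ kleinJ z₀) :
    ∃ C : ℝ, ∀ᶠ p : ℍ × ℍ in 𝓝 (τ₀, z₀), ‖kernel8 p.1 p.2‖ ≤ C ∧ ‖kernel24 p.1 p.2‖ ≤ C := by
  obtain ⟨-, -, -, -, c8, c24⟩ := continuousAt_kernels_joint h
  have h8 : ∀ᶠ p : ℍ × ℍ in 𝓝 (τ₀, z₀), ‖kernel8 p.1 p.2‖ ≤ ‖kernel8 τ₀ z₀‖ + 1 := by
    have := (continuous_norm.continuousAt.comp c8).eventually (eventually_le_nhds (lt_add_one ‖kernel8 τ₀ z₀‖))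
    exact this
  have h24 : ∀ᶠ p : ℍ × ℍ in 𝓝 (τ₀, z₀), ‖kernel24 p.1 p.2‖ ≤ ‖kernel24 τ₀ z₀‖ + 1 := by
    have := (continuous_norm.continuousAt.comp c24).eventually (eventually_le_nhds (lt_add_one ‖kernel24 τ₀ z₀‖))
    exact this
  refine ⟨max (‖kernel8 τ₀ z₀‖ + 1) (‖kernel24 τ₀ z₀‖ + 1), ?_⟩
  filter_upwards [h8, h24] with p hp hq
  exact ⟨hp.trans (le_max_left _ _), hq.trans (le_max_right _ _)⟩

end Literature.NumberTheory.ModularForms
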